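import Mathlib.Analysis.Normed.Group.Tannery
import Literature.Analysis.Complex.HedgehogGeometry
import Literature.Analysis.Complex.Lavrentiev
import HarnessLib

/-!
# Vanishing moments on a hedgehog of spokes (Lavrentiev ⇒ the spoke classes vanish)

Topic `Literature/Analysis/Complex`, an application of Mergelyan's theorem in Lavrentiev's form
(`Literature.Analysis.Complex.functional_eq_zero_of_forall_moment_eq_zero`: on a compact
`K ⊆ ℂ` with EMPTY INTERIOR and connected complement a sup-norm-dominated functional killing the
monomials `zⁿ`, `n ≥ n₀`, kills every continuous function vanishing near `0`) to HEDGEHOGS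
(`Literature.Analysis.Complex.hedgehog`): countably many radial spokes `{χⱼ e^{-lh} : l ≥ cⱼ}`
(`|χⱼ| = 1`, `h > 0`, `cⱼ ≥ 0`, `{j | cⱼ ≤ C}` finite for every `C`), each carrying the image of
a complex measure `Sⱼ dmⱼ` from `[cⱼ, ∞)`, with `∑ⱼ sup |Sⱼ| · mⱼ(ℝ) < ∞`.

* `norm_integral_spoke_le`, `tsum_integral_spoke_le` — the functional
  `Λ F = ∑ⱼ ∫ F(χⱼ e^{-lh}) Sⱼ(l) dmⱼ(l)` converges absolutely, with the bound
  `‖Λ F‖ ≤ sup_K |F| · ∑ⱼ Bⱼ mⱼ(ℝ)`;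
* `hasSum_integral_spoke_eq_zero` — if the hedgehog moments `∑ⱼ χⱼⁿ ∫ e^{-lnh} Sⱼ dmⱼ` vanish
  for `n ≥ n₀` then `Λ F = 0` for every continuous `F` vanishing near `0` (Lavrentiev);
* `hasSum_class_integral_eq_zero` — localisation to one direction `χ₀`: testing against
  `F(z) = g(|z|) Ψ(z/|z|)`, `Ψ` a continuous function with `Ψ(χ₀) = 1` vanishing at the finitely
  many other directions of spokes longer than `r`, gives `∑_{j : χⱼ = χ₀} ∫ g(e^{-lh}) Sⱼ dmⱼ = 0`
  for every continuous `g` vanishing on `(-∞, r]`;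
* **`laplace_class_eq_zero_of_hedgehog_moments`** — letting `g(t) → t^{X/h}` boundedly
  (dominated convergence on each spoke, Tannery's theorem over the class): for every direction
  `χ₀` and every real `X > 0`, `∑_{j : χⱼ = χ₀} ∫ e^{-lX} Sⱼ(l) dmⱼ(l) = 0`, the series converging
  absolutely.

This is the uniqueness statement behind "observer equations along an arithmetic progression of
depths and registries": such equations are the moments of a measure on a hedgehog, and Mergelyan's
theorem kills them class by class. [cite: Rudin1987, Thm 20.5] [cite: Gaier1987, Ch. III §2.A Thm 1]
(Lavrentiev 1934: `P(K) = C(K)` iff `K° = ∅` and `ℂ ∖ K` is connected.)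
-/

noncomputable section

namespace Literature.Analysis.Complex

open _root_.MeasureTheory Set Filter Metric _root_.Complex
open scoped Real _root_.Topology

section HedgehogMoments

variable {ι : Type*} {χ : ι → ℂ} {c : ι → ℝ} {h : ℝ} {m : ι → Measure ℝ} {S : ι → ℝ → ℂ}
  {B : ι → ℝ}

/-- A spoke integral `∫ F(χⱼ e^{-lh}) Sⱼ(l) dmⱼ(l)` against a measure carried by `[cⱼ, ∞)` with a
bounded density is absolutely convergent and bounded by `sup |F| · Bⱼ · mⱼ(ℝ)`. [folklore] -/
theorem norm_integral_spoke_le [∀ j, IsFiniteMeasure (m j)] (j : ι) (hm : m j (Iio (c j)) = 0)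
    (hS : Measurable (S j)) (hB : ∀ l, ‖S j l‖ ≤ B j) {F : ℂ → ℂ} (hF : Measurable F) {C : ℝ}
    (hC : ∀ l, c j ≤ l → ‖F (χ j * (Real.exp (-(l * h)) : ℂ))‖ ≤ C) :
    Integrable (fun l => F (χ j * (Real.exp (-(l * h)) : ℂ)) * S j l) (m j) ∧
      ‖∫ l, F (χ j * (Real.exp (-(l * h)) : ℂ)) * S j l ∂(m j)‖ ≤ C * B j * (m j).real univ := by
  have hae : ∀ᵐ l ∂(m j), ‖F (χ j * (Real.exp (-(l * h)) : ℂ)) * S j l‖ ≤ C * B j := by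
    filter_upwards [measure_eq_zero_iff_ae_notMem.1 hm] with l hl
    rw [mem_Iio, not_lt] at hl
    rw [norm_mul]
    exact mul_le_mul (hC l hl) (hB l) (norm_nonneg _) ((norm_nonneg _).trans (hC l hl))
  have hmeas : AEStronglyMeasurable (fun l => F (χ j * (Real.exp (-(l * h)) : ℂ)) * S j l) (m j) :=
    ((hF.comp (by fun_prop)).mul hS).aestronglyMeasurable
  exact ⟨Integrable.of_bound hmeas _ hae, norm_integral_le_of_norm_le_const hae⟩

/-- Summing the spoke integrals: absolute convergence and the bound
`‖∑ⱼ ∫ F(χⱼ e^{-lh}) Sⱼ dmⱼ‖ ≤ sup |F| · ∑ⱼ Bⱼ mⱼ(ℝ)`. [folklore] -/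
theorem tsum_integral_spoke_le [∀ j, IsFiniteMeasure (m j)] (hm : ∀ j, m j (Iio (c j)) = 0)
    (hS : ∀ j, Measurable (S j)) (hB : ∀ j l, ‖S j l‖ ≤ B j)
    (hsum : Summable fun j => B j * (m j).real univ) {F : ℂ → ℂ} (hF : Measurable F) {C : ℝ}
    (hC : ∀ j l, c j ≤ l → ‖F (χ j * (Real.exp (-(l * h)) : ℂ))‖ ≤ C) :
    Summable (fun j => ∫ l, F (χ j * (Real.exp (-(l * h)) : ℂ)) * S j l ∂(m j)) ∧
      ‖∑' j, ∫ l, F (χ j * (Real.exp (-(l * h)) : ℂ)) * S j l ∂(m j)‖ ≤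
        C * ∑' j, B j * (m j).real univ := by
  have hle : ∀ j, ‖∫ l, F (χ j * (Real.exp (-(l * h)) : ℂ)) * S j l ∂(m j)‖ ≤
      C * (B j * (m j).real univ) :=
    fun j => (mul_assoc C _ _) ▸ (norm_integral_spoke_le j (hm j) (hS j) (hB j) hF (hC j)).2
  refine ⟨.of_norm_bounded (hsum.mul_left C) hle, ?_⟩
  rw [← tsum_mul_left]
  exact tsum_of_norm_bounded (hsum.mul_left C).hasSum hle

/-- **Lavrentiev on a hedgehog.** Under the hypotheses of
`laplace_class_eq_zero_of_hedgehog_moments`, the functional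
`F ↦ ∑ⱼ ∫ F(χⱼ e^{-lh}) Sⱼ(l) dmⱼ(l)` annihilates every continuous `F` vanishing near `0`.
[cite: Gaier1987, Ch. III §2.A Thm 1] -/
theorem hasSum_integral_spoke_eq_zero [Countable ι] [∀ j, IsFiniteMeasure (m j)]
    (hχ : ∀ j, ‖χ j‖ = 1) (hc : ∀ j, 0 ≤ c j) (hfin : ∀ C : ℝ, {j : ι | c j ≤ C}.Finite)
    (hh : 0 < h) (hm : ∀ j, m j (Iio (c j)) = 0) (hS : ∀ j, Measurable (S j))
    (hB : ∀ j l, ‖S j l‖ ≤ B j) (hsum : Summable fun j => B j * (m j).real univ) {n₀ : ℕ}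
    (hmom : ∀ n : ℕ, n₀ ≤ n →
      HasSum (fun j => χ j ^ n * ∫ l, Complex.exp (-((l * (n * h) : ℝ) : ℂ)) * S j l ∂(m j)) 0)
    {f : ℂ → ℂ} (hf : Continuous f) {r : ℝ} (hr : 0 < r) (hf0 : ∀ z, ‖z‖ < r → f z = 0) :
    HasSum (fun j => ∫ l, f (χ j * (Real.exp (-(l * h)) : ℂ)) * S j l ∂(m j)) 0 := by
  have hK := isCompact_hedgehog hχ hc hfin hh
  have hKφ : ∀ j l, c j ≤ l → χ j * (Real.exp (-(l * h)) : ℂ) ∈ hedgehog χ c h :=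
    fun j l hl => mul_exp_mem_hedgehog j hl
  have hcts : ∀ F : ℂ → ℂ, Continuous F →
      ∃ C, ∀ j l, c j ≤ l → ‖F (χ j * (Real.exp (-(l * h)) : ℂ))‖ ≤ C := by
    intro F hF
    obtain ⟨C, hC⟩ := hK.exists_bound_of_continuousOn hF.continuousOn
    exact ⟨C, fun j l hl => hC _ (hKφ j l hl)⟩
  -- the functional `Λ F = ∑ⱼ ∫ F(χⱼ e^{-lh}) Sⱼ dmⱼ` is additive, homogeneous, dominated, ...
  have hadd : ∀ F G : ℂ → ℂ, Continuous F → Continuous G →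
      (∑' j, ∫ l, (F + G) (χ j * (Real.exp (-(l * h)) : ℂ)) * S j l ∂(m j)) =
        (∑' j, ∫ l, F (χ j * (Real.exp (-(l * h)) : ℂ)) * S j l ∂(m j)) +
          ∑' j, ∫ l, G (χ j * (Real.exp (-(l * h)) : ℂ)) * S j l ∂(m j) := by
    intro F G hF hG
    obtain ⟨CF, hCF⟩ := hcts F hF
    obtain ⟨CG, hCG⟩ := hcts G hG
    rw [← (tsum_integral_spoke_le hm hS hB hsum hF.measurable hCF).1.tsum_add
      (tsum_integral_spoke_le hm hS hB hsum hG.measurable hCG).1]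
    refine tsum_congr fun j => ?_
    simp only [Pi.add_apply, add_mul]
    exact integral_add (norm_integral_spoke_le j (hm j) (hS j) (hB j) hF.measurable (hCF j)).1
      (norm_integral_spoke_le j (hm j) (hS j) (hB j) hG.measurable (hCG j)).1
  have hmul : ∀ (a : ℂ) (F : ℂ → ℂ), Continuous F →
      (∑' j, ∫ l, a * F (χ j * (Real.exp (-(l * h)) : ℂ)) * S j l ∂(m j)) =
        a * ∑' j, ∫ l, F (χ j * (Real.exp (-(l * h)) : ℂ)) * S j l ∂(m j) := by
    intro a F _
    simp only [mul_assoc, integral_const_mul]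
    exact tsum_mul_left
  have hbd : ∀ (F : ℂ → ℂ) (ε : ℝ), Continuous F → (∀ z ∈ hedgehog χ c h, ‖F z‖ ≤ ε) →
      ‖∑' j, ∫ l, F (χ j * (Real.exp (-(l * h)) : ℂ)) * S j l ∂(m j)‖ ≤
        (∑' j, B j * (m j).real univ) * ε := by
    intro F ε hF hFε
    rw [mul_comm]
    exact (tsum_integral_spoke_le hm hS hB hsum hF.measurable fun j l hl => hFε _ (hKφ j l hl)).2
  -- ... and annihilates `zⁿ`, `n ≥ n₀` (the hedgehog moments)
  have hφn : ∀ (n : ℕ) j (l : ℝ), (χ j * (Real.exp (-(l * h)) : ℂ)) ^ n * S j l =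
      χ j ^ n * (Complex.exp (-((l * (n * h) : ℝ) : ℂ)) * S j l) := by
    intro n j l
    rw [mul_pow, Complex.ofReal_exp, ← Complex.exp_nat_mul, mul_assoc]
    congr 3
    push_cast
    ring
  have hmom' : ∀ n : ℕ, n₀ ≤ n →
      (∑' j, ∫ l, (χ j * (Real.exp (-(l * h)) : ℂ)) ^ n * S j l ∂(m j)) = 0 := by
    intro n hn
    simp_rw [hφn n, integral_const_mul]
    exact (hmom n hn).tsum_eq
  have key : (∑' j, ∫ l, f (χ j * (Real.exp (-(l * h)) : ℂ)) * S j l ∂(m j)) = 0 :=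
    functional_eq_zero_of_forall_moment_eq_zero hK (interior_hedgehog_eq_empty hχ)
      (isPreconnected_compl_hedgehog hχ hc hh)
      (Λ := fun F => ∑' j, ∫ l, F (χ j * (Real.exp (-(l * h)) : ℂ)) * S j l ∂(m j))
      hadd hmul hbd hmom' hf hr hf0
  obtain ⟨C, hC⟩ := hcts f hf
  have hs := (tsum_integral_spoke_le hm hS hB hsum hf.measurable hC).1.hasSum
  rwa [key] at hs

/-- **Localisation to a spoke class.** Under the hypotheses of
`laplace_class_eq_zero_of_hedgehog_moments`, for every direction `χ₀`, every `r > 0` and every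
continuous `g : ℝ → ℂ` vanishing on `(-∞, r]`,
`∑_{j : χⱼ = χ₀} ∫ g(e^{-lh}) Sⱼ(l) dmⱼ(l) = 0`: test the hedgehog functional against
`F(z) = g(|z|) Ψ(z/|z|)` with `Ψ(χ₀) = 1` and `Ψ(χⱼ) = 0` on the finitely many other directions
of spokes longer than `r`. [cite: Gaier1987, Ch. III §2.A Thm 1] -/
theorem hasSum_class_integral_eq_zero [Countable ι] [∀ j, IsFiniteMeasure (m j)]
    (hχ : ∀ j, ‖χ j‖ = 1) (hc : ∀ j, 0 ≤ c j) (hfin : ∀ C : ℝ, {j : ι | c j ≤ C}.Finite)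
    (hh : 0 < h) (hm : ∀ j, m j (Iio (c j)) = 0) (hS : ∀ j, Measurable (S j))
    (hB : ∀ j l, ‖S j l‖ ≤ B j) (hsum : Summable fun j => B j * (m j).real univ) {n₀ : ℕ}
    (hmom : ∀ n : ℕ, n₀ ≤ n →
      HasSum (fun j => χ j ^ n * ∫ l, Complex.exp (-((l * (n * h) : ℝ) : ℂ)) * S j l ∂(m j)) 0)
    (χ₀ : ℂ) {g : ℝ → ℂ} (hg : Continuous g) {r : ℝ} (hr : 0 < r) (hg0 : ∀ t, t ≤ r → g t = 0) :
    HasSum (fun j : {j : ι // χ j = χ₀} => ∫ l, g (Real.exp (-(l * h))) * S j l ∂(m j)) 0 := by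
  classical
  -- the finitely many long spokes in other directions, and a separating function `Ψ`
  set J : Finset ι := ((hfin (-Real.log r / h)).subset (fun j (hj : c j ≤ -Real.log r / h ∧
    χ j ≠ χ₀) => hj.1)).toFinset with hJ
  have hJmem : ∀ j, j ∈ J ↔ c j ≤ -Real.log r / h ∧ χ j ≠ χ₀ := fun j => by
    rw [hJ, Set.Finite.mem_toFinset]; rfl
  set Ψ : ℂ → ℂ := fun w => ∏ i ∈ J, ((‖w - χ i‖ / ‖χ₀ - χ i‖ : ℝ) : ℂ) with hΨ
  have hΨc : Continuous Ψ := continuous_finsetProd J fun i _ => by fun_prop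
  have hΨ₀ : Ψ χ₀ = 1 := Finset.prod_eq_one fun i hi => by
    rw [div_self (norm_ne_zero_iff.2 (sub_ne_zero.2 ((hJmem i).1 hi).2.symm)), Complex.ofReal_one]
  have hΨJ : ∀ j ∈ J, Ψ (χ j) = 0 := fun j hj => Finset.prod_eq_zero hj (by simp)
  -- the test function `F(z) = g(|z|) Ψ(z/|z|)`
  set F : ℂ → ℂ := fun z => g ‖z‖ * Ψ ((‖z‖ : ℂ)⁻¹ * z) with hF
  have hF0 : ∀ z, ‖z‖ < r → F z = 0 := fun z hz => by
    simp only [hF, hg0 _ hz.le, zero_mul]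
  have hFc : Continuous F := by
    refine continuous_iff_continuousAt.2 fun z => ?_
    by_cases hz : z = 0
    · subst hz
      refine Filter.EventuallyEq.continuousAt (y := 0) ?_
      filter_upwards [Metric.ball_mem_nhds (0 : ℂ) hr] with w hw
      exact hF0 w (mem_ball_zero_iff.1 hw)
    · refine ((hg.comp continuous_norm).continuousAt).mul (hΨc.continuousAt.comp ?_)
      exact ((Complex.continuous_ofReal.comp continuous_norm).continuousAt.inv₀
        (by simpa using hz)).mul continuousAt_id
  -- its values on the spokes
  have hFφ : ∀ j (l : ℝ), F (χ j * (Real.exp (-(l * h)) : ℂ)) * S j l =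
      Ψ (χ j) * (g (Real.exp (-(l * h))) * S j l) := by
    intro j l
    have hρ : (Real.exp (-(l * h)) : ℂ) ≠ 0 := Complex.ofReal_ne_zero.2 (Real.exp_pos _).ne'
    simp only [hF, norm_unit_mul_ofReal_exp hχ]
    rw [mul_comm (χ j), ← mul_assoc, inv_mul_cancel₀ hρ, one_mul]
    ring
  have H := hasSum_integral_spoke_eq_zero hχ hc hfin hh hm hS hB hsum hmom hFc hr hF0
  simp_rw [hFφ, integral_const_mul] at H
  -- only the class of `χ₀` contributes
  have hae : ∀ j, ∀ᵐ l ∂(m j), c j ≤ l := fun j =>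
    (measure_eq_zero_iff_ae_notMem.1 (hm j)).mono fun l hl => not_lt.1 hl
  have hsupp : (Function.support fun j => Ψ (χ j) *
      ∫ l, g (Real.exp (-(l * h))) * S j l ∂(m j)) ⊆ {j | χ j = χ₀} := by
    intro j hj
    rw [Function.mem_support, ne_eq] at hj
    by_contra hne
    apply hj
    show Ψ (χ j) * ∫ l, g (Real.exp (-(l * h))) * S j l ∂(m j) = 0
    by_cases hcj : c j ≤ -Real.log r / h
    · rw [hΨJ j ((hJmem j).2 ⟨hcj, hne⟩), zero_mul]
    · rw [integral_eq_zero_of_ae, mul_zero]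
      filter_upwards [hae j] with l hl
      have hlt : Real.exp (-(l * h)) < r := by
        rw [← Real.exp_log hr, Real.exp_lt_exp, neg_lt, ← div_lt_iff₀ hh]
        exact (not_le.1 hcj).trans_le hl
      simp [hg0 _ hlt.le]
  have H' := (hasSum_subtype_iff_of_support_subset hsupp).2 H
  have heq : ((fun j => Ψ (χ j) * ∫ l, g (Real.exp (-(l * h))) * S j l ∂(m j)) ∘ (↑) :
      {j | χ j = χ₀} → ℂ) =
      fun j : {j | χ j = χ₀} => ∫ l, g (Real.exp (-(l * h))) * S j l ∂(m j) := by
    funext j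
    have hj : χ j = χ₀ := j.2
    simp [hj, hΨ₀]
  rw [heq] at H'
  exact H'

/-- **Moments on a hedgehog determine the spoke classes.** Let `ι` be countable, `χ : ι → ℂ`
unimodular, `c : ι → ℝ` nonnegative with `{j | cⱼ ≤ C}` finite for all `C`, `h > 0`; let `mⱼ` be
finite measures on `ℝ` with `mⱼ (-∞, cⱼ) = 0`, `Sⱼ : ℝ → ℂ` measurable with `‖Sⱼ l‖ ≤ Bⱼ` and
`∑ⱼ Bⱼ · mⱼ(ℝ) < ∞`. If the hedgehog moments vanish,
`∑ⱼ χⱼⁿ ∫ e^{-l n h} Sⱼ(l) dmⱼ(l) = 0` for every `n ≥ n₀`, then for every direction `χ₀` and every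
real `X > 0`, `∑_{j : χⱼ = χ₀} ∫ e^{-lX} Sⱼ(l) dmⱼ(l) = 0` (the series over the class converging
absolutely). [cite: Rudin1987, Thm 20.5] -/
theorem laplace_class_eq_zero_of_hedgehog_moments {ι : Type*} [Countable ι] {χ : ι → ℂ}
    (hχ : ∀ j, ‖χ j‖ = 1) {c : ι → ℝ} (hc : ∀ j, 0 ≤ c j) (hfin : ∀ C : ℝ, {j : ι | c j ≤ C}.Finite)
    {h : ℝ} (hh : 0 < h) {m : ι → Measure ℝ} [∀ j, IsFiniteMeasure (m j)]
    (hm : ∀ j, m j (Set.Iio (c j)) = 0) {S : ι → ℝ → ℂ} (hS : ∀ j, Measurable (S j))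
    {B : ι → ℝ} (hB : ∀ j l, ‖S j l‖ ≤ B j) (hsum : Summable fun j => B j * (m j).real Set.univ)
    {n₀ : ℕ}
    (hmom : ∀ n : ℕ, n₀ ≤ n →
      HasSum (fun j => χ j ^ n * ∫ l, Complex.exp (-((l * (n * h) : ℝ) : ℂ)) * S j l ∂(m j)) 0)
    (χ₀ : ℂ) {X : ℝ} (hX : 0 < X) :
    HasSum (fun j : {j : ι // χ j = χ₀} =>
      ∫ l, Complex.exp (-(l : ℂ) * X) * S j l ∂(m j)) 0 := by
  have hXh : 0 < X / h := div_pos hX hh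
  -- cut-offs `gₖ(t) = ηₖ(t) t^{X/h}` vanishing on `(-∞, 1/(k+1)]`
  set gk : ℕ → ℝ → ℂ := fun k t =>
    ((max 0 (min 1 ((k + 1 : ℝ) * t - 1)) * t ^ (X / h) : ℝ) : ℂ) with hgk
  have hgc : ∀ k, Continuous (gk k) := fun k =>
    Complex.continuous_ofReal.comp ((by fun_prop : Continuous fun t : ℝ =>
      max 0 (min 1 ((k + 1 : ℝ) * t - 1))).mul (Real.continuous_rpow_const hXh.le))
  have hg0 : ∀ (k : ℕ) (t : ℝ), t ≤ 1 / (k + 1 : ℝ) → gk k t = 0 := by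
    intro k t ht
    have h1 : (k + 1 : ℝ) * t - 1 ≤ 0 := by
      rw [sub_nonpos]
      calc (k + 1 : ℝ) * t ≤ (k + 1 : ℝ) * (1 / (k + 1 : ℝ)) := by gcongr
        _ = 1 := mul_one_div_cancel (by positivity)
    simp only [hgk, max_eq_left (min_le_of_right_le h1), zero_mul, Complex.ofReal_zero]
  have hk : ∀ k : ℕ, HasSum (fun j : {j : ι // χ j = χ₀} =>
      ∫ l, gk k (Real.exp (-(l * h))) * S j l ∂(m j)) 0 := fun k =>
    hasSum_class_integral_eq_zero hχ hc hfin hh hm hS hB hsum hmom χ₀ (hgc k)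
      (by positivity) (hg0 k)
  -- `gₖ(e^{-lh}) → e^{-lX}` boundedly on `l ≥ 0`
  have hle : ∀ k (l : ℝ), 0 ≤ l → ‖gk k (Real.exp (-(l * h)))‖ ≤ 1 := by
    intro k l hl
    have h0 : 0 ≤ max 0 (min 1 ((k + 1 : ℝ) * Real.exp (-(l * h)) - 1)) := le_max_left _ _
    have hp : 0 ≤ Real.exp (-(l * h)) ^ (X / h) := Real.rpow_nonneg (Real.exp_pos _).le _
    simp only [hgk, Complex.norm_real, Real.norm_of_nonneg (mul_nonneg h0 hp)]
    refine mul_le_one₀ (max_le zero_le_one (min_le_left _ _)) hp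
      (Real.rpow_le_one (Real.exp_pos _).le ?_ hXh.le)
    rw [Real.exp_le_one_iff, neg_nonpos]
    exact mul_nonneg hl hh.le
  have hlim : ∀ l : ℝ, Tendsto (fun k => gk k (Real.exp (-(l * h)))) atTop
      (𝓝 (Complex.exp (-(l : ℂ) * X))) := by
    intro l
    have ht0 : 0 < Real.exp (-(l * h)) := Real.exp_pos _
    have hlimit : ((Real.exp (-(l * h)) ^ (X / h) : ℝ) : ℂ) = Complex.exp (-(l : ℂ) * X) := by
      rw [← Real.exp_mul, Complex.ofReal_exp, show -(l * h) * (X / h) = -(l * X) by field_simp]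
      congr 1
      push_cast
      ring
    rw [← hlimit]
    refine tendsto_const_nhds.congr' ?_
    obtain ⟨N, hN⟩ := exists_nat_ge (2 / Real.exp (-(l * h)))
    filter_upwards [eventually_ge_atTop N] with k hk
    have h1 : 1 ≤ (k + 1 : ℝ) * Real.exp (-(l * h)) - 1 := by
      rw [le_sub_iff_add_le, one_add_one_eq_two, ← div_le_iff₀ ht0]
      exact hN.trans (by exact_mod_cast hk.trans (Nat.le_succ k))
    simp only [hgk, min_eq_left h1, max_eq_right (zero_le_one' ℝ), one_mul]
  have hae : ∀ j, ∀ᵐ l ∂(m j), c j ≤ l := fun j =>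
    (measure_eq_zero_iff_ae_notMem.1 (hm j)).mono fun l hl => not_lt.1 hl
  have hbd : ∀ k j, ∀ᵐ l ∂(m j), ‖gk k (Real.exp (-(l * h))) * S j l‖ ≤ B j := by
    intro k j
    filter_upwards [hae j] with l hl
    rw [norm_mul]
    exact (mul_le_mul (hle k l ((hc j).trans hl)) (hB j l) (norm_nonneg _) zero_le_one).trans_eq
      (one_mul _)
  -- dominated convergence on each spoke ...
  have hj : ∀ j, Tendsto (fun k => ∫ l, gk k (Real.exp (-(l * h))) * S j l ∂(m j)) atTop
      (𝓝 (∫ l, Complex.exp (-(l : ℂ) * X) * S j l ∂(m j))) := fun j =>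
    tendsto_integral_of_dominated_convergence (fun _ => B j)
      (fun k => (((hgc k).measurable.comp (by fun_prop)).mul (hS j)).aestronglyMeasurable)
      (integrable_const _) (hbd · j)
      (Eventually.of_forall fun l => (hlim l).mul tendsto_const_nhds)
  -- ... and Tannery's theorem over the class
  have hT := tendsto_tsum_of_dominated_convergence
    (f := fun k (j : {j : ι // χ j = χ₀}) => ∫ l, gk k (Real.exp (-(l * h))) * S j l ∂(m j))
    (bound := fun j : {j : ι // χ j = χ₀} => B j * (m j).real univ)
    (hsum.subtype _) (fun j => hj j)
    (Eventually.of_forall fun k j => norm_integral_le_of_norm_le_const (hbd k j))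
  have h0 : (fun k => ∑' j : {j : ι // χ j = χ₀},
      ∫ l, gk k (Real.exp (-(l * h))) * S j l ∂(m j)) = fun _ => 0 :=
    funext fun k => (hk k).tsum_eq
  rw [h0] at hT
  have hlim0 := tendsto_nhds_unique (tendsto_const_nhds (x := (0 : ℂ))) hT
  -- the limit series converges absolutely
  have hbd' : ∀ j, ∀ᵐ (l : ℝ) ∂(m j), ‖Complex.exp (-(l : ℂ) * X) * S j l‖ ≤ B j := by
    intro j
    filter_upwards [hae j] with l hl
    rw [norm_mul, Complex.norm_exp]
    refine (mul_le_mul ?_ (hB j l) (norm_nonneg _) zero_le_one).trans_eq (one_mul _)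
    rw [Real.exp_le_one_iff]
    simp only [neg_mul, Complex.neg_re, Complex.mul_re, Complex.ofReal_re, Complex.ofReal_im,
      zero_mul, sub_zero, neg_nonpos]
    exact mul_nonneg ((hc j).trans hl) hX.le
  have hs : Summable fun j : {j : ι // χ j = χ₀} =>
      ∫ l, Complex.exp (-(l : ℂ) * X) * S j l ∂(m j) :=
    .of_norm_bounded (hsum.subtype _) fun j => norm_integral_le_of_norm_le_const (hbd' j)
  rw [hlim0]
  exact hs.hasSum

end HedgehogMoments

end Literature.Analysis.Complex
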